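/-
Copyright (c) 2026 the pub-hodgecm-mathlib formalisation cell (harness21).  Prover seat hodgecm-mathlib-A-p12 (g23), 2026-09-01.  «S3-ram» seeding wave (LEAD F0P3a-plan (g12)
T11-62; owner F0P3a-p06 (g15)): organ «T6-2r ∕ H²-ram», `U₂`-level — the `χ⁰` (self-dual EDGE) column of STUB B₂ of the P-2-ram skeleton (α₂) from the `χ♯` (VERTEX) column.
-/
import Literature.NumberTheory.Automorphic.UnitaryTwoEulerPoincareEllipticRamified            -- ★ B-p04 (g35): Kottwitz's (E) `#Fix(U₂⧸C) + #Fix(U₂⧸C′) = #Fix(U₂⧸I) + 1` at a tame-ramified place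
import Literature.NumberTheory.Automorphic.UnitaryTwoEdgeStabilizerVertexAverageRamified      -- ★ F0P3a-p04 (g18): the flip `kJ`, `coe_localNonsplitEquiv_{mul,inv,conj}`; ⊇ ★ FILE A residual dichotomy, `P♯` dictionary, transports
import HarnessLib

/-!
# A DEEP elliptic element of ramified `U(1,1)` fixes one more `ϖ`-modular VERTEX than self-dual EDGES: `#Fix_γ(U₂ ⧸ K⁰) + 1 = #Fix_γ(U₂ ⧸ K♯)`
(Kottwitz 1988 §2; Tits 1979 §3.9; Serre, *Trees* I §6.1, II §1.3)

Topic `NumberTheory/Automorphic`; namespace `Literature.NumberTheory.Automorphic.UnitaryGroup`.  THEOREMS ONLY (no definition, no instance, no notation, no named fact,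
no `sorry`); kernel lane `--supports stmt-HodgeConjecture-24833`.  Cell `pub/hodgecm-mathlib` (D-0151), crux H413; «S3-ram» seeding wave (LEAD F0P3a-plan (g12) T11-62; owner
F0P3a-p06 (g15)); seat A-p12 (g23).  Organ «T6-2r ∕ H²-ram», `U₂ = U(Φ₂)(L⁺_v)`-level: STUB B₂ of the P-2-ram skeleton (α₂) v0.4 (6c8f4919) has TWO H-columns,
`χ⁰ = 1_{K⁰ × U₁}` (`K⁰ = U₂ ∩ GL₂(𝒪_w)`, the stabiliser WITH INVERSION of a self-dual EDGE of the tree of `SL₂(L⁺_v)`) and `χ♯ = 1_{K♯ × U₁}` (`K♯ = U₂ ∩ D GL₂(𝒪_w) D⁻¹`,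
`D = diag(1, η)`, the stabiliser of a `ϖ`-MODULAR VERTEX); ★ `UnitaryTwoRamifiedEllipticFixedModularVertices` (this seat, p847070) counts the `K♯`-column.  THIS FILE
derives the `K⁰`-column from it: for a DEEP (`|tr γ_w − 2|_w < 1`) regular `γ ∈ U₂` with compact centraliser, **`#Fix_γ(U₂ ⧸ K⁰) + 1 = #Fix_γ(U₂ ⧸ K♯)`** — the fixed
set of a type-preserving elliptic automorphism is a finite subtree, whose edges number one less than its vertices.
HONEST LABEL: HC_CM is proved only modulo the cell's 2 remaining named inputs (hLiu418 24832, h413 24833) until rung 0 closes; nothing printed is asserted here.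

THE MATHEMATICS.  `I := K⁰ ∩ K♯` is the Iwahori subgroup (flags); ★ B-p04's Euler–Poincaré relation on the barycentric tree reads `#Fix(U₂⧸K⁰) + #Fix(U₂⧸K♯) = #Fix(U₂⧸I) + 1`
(★ `natCard_fixedBy_add_eq_natCard_fixedBy_add_one_of_isRegularElt_of_ramified`).  Two facts about the edge stabiliser `K⁰` close the count:
* `[K⁰ : I] = 2` (§2 `relIndex_inf_eq_two_of_ramified`): by ★ F0P3a-p04's RESIDUAL DICHOTOMY (`valued_apply_dichotomy_of_mem_glInt_of_ramified`) an element of `K⁰` is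
  residually diagonal (then it lies in `K♯`, ★ `glDiagonal_inv_mul_mul_glDiagonal_mem_glInt_of_diagType`) or residually antidiagonal (then it does NOT: `|κ₁₀| ≤ |η|` and
  `|κ₁₁| < 1` would force `|det κ| < 1`), and left multiplication by the flip `kJ` (★ `exists_mem_localNonsplitEquiv_eq_antidiagOne`, `E₂ kJ = antidiag(1,1)`) exchanges the two
  types — Mathlib's `Subgroup.index_eq_two_iff'`.
* NO INVERSIONS for deep `γ` (§2 `conj_mem_of_conj_mem_of_deep_of_ramified`): a conjugate `κ = y⁻¹γy ∈ K⁰` has `tr κ = tr γ_w`, `|tr γ_w| = |2|_w = 1`, so `κ` is not residually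
  antidiagonal (`|κ₀₀|, |κ₁₁| < 1 ⇒ |tr κ| < 1`); hence `κ ∈ K♯`, i.e. `κ ∈ I`.
With the generic covering count §1 (`#Fix_γ(G⧸I) = #Fix_γ(G⧸C)·[C : I]` whenever every conjugate of `γ` inside `C` lies in `I ≤ C`) this gives `#Fix(U₂⧸I) = 2·#Fix(U₂⧸K⁰)`, whence
the head.  (Labesse–Langlands' numbers: at discriminant depth `2n` the fixed ball is vertex-centred, `1 + (q+1)(qⁿ−1)∕(q−1)` vertices and `(q+1)(qⁿ−1)∕(q−1)` edges; at depth
`2n+1` it is edge-centred, `2(q^{n+1}−1)∕(q−1)` vertices and one edge less — B-p14 (g38)'s certificate «P-2-ram profiles» `(m⁰, m♯)`.)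

* §1 `natCard_fixedBy_quotient_eq_mul_relIndex_of_forall_conj_mem` (any group).
* §2 (`U₂` at a tame-ramified `w`, subgroups `C ↔ GL₂(𝒪_w)`, `C′ ↔ D_η GL₂(𝒪_w) D_η⁻¹` given by their `E₂`-dictionaries): `not_coe_mem_map_conj_glDiagonal_of_antidiagType`,
  `relIndex_inf_eq_two_of_ramified`, `conj_mem_of_conj_mem_of_deep_of_ramified`, HEAD **`natCard_fixedBy_add_one_eq_natCard_fixedBy_of_deep_of_ramified`**.

## References
* [Kottwitz1988] R. E. Kottwitz, *Tamagawa numbers*, Ann. of Math. 127 (1988), §2 Theorem 2 (Euler–Poincaré functions; the fixed subtree of an elliptic element).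
* [Tits1979] J. Tits, *Reductive groups over local fields*, PSPM 33.1 (1979), §2.7, §3.9 (ramified quasi-split `U(2)`: the tree of `SL₂`, vertex vs edge stabilisers).
* [Serre1980Trees] J.-P. Serre, *Trees* (1980), Ch. I §6.1 (no inversions; orbit–stabiliser), Ch. II §1.3 (the Iwahori subgroup, index `2` in the edge stabiliser).
* [LabesseLanglands1979] J.-P. Labesse, R. P. Langlands, *L-indistinguishability for SL(2)*, Canad. J. Math. 31 (1979), §2 p. 8 (fixed balls of elliptic tori).
-/

set_option autoImplicit false

noncomputable section

open scoped ValuativeRel Matrix MatrixGroups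
open Matrix ValuativeRel NumberField IsDedekindDomain MulAction

namespace Literature.NumberTheory.Automorphic.UnitaryGroup

open Literature.NumberTheory.Automorphic Literature.NumberTheory.Automorphic.HermitianLatticeTree Literature.NumberTheory.Rogawski1990

/-! ## §1 Fixed cosets above a subgroup that absorbs every conjugate (any group) -/

section Generic

/-- **`#Fix_γ(G ⧸ I) = #Fix_γ(G ⧸ C) · [C : I]`** for subgroups `I ≤ C` such that every conjugate of `γ` lying in `C` already lies in `I`: the projection `G ⧸ I → G ⧸ C`
restricts to a `[C : I]`-to-one map of fixed sets (a fixed `C`-coset `yC` has `y⁻¹γy ∈ C`, hence `∈ I`, and so do all its translates `ykC`, `k ∈ C`).  `Nat.card` on both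
sides (`0` for infinite sets); Mathlib's `Subgroup.quotientEquivProdOfLE`. [cite: Serre1980Trees, Ch. I §6.1] [cite: Kottwitz1988, §2] -/
theorem natCard_fixedBy_quotient_eq_mul_relIndex_of_forall_conj_mem {G : Type*} [Group G] {I C : Subgroup G} (hIC : I ≤ C) (γ : G)
    (h : ∀ y : G, y⁻¹ * γ * y ∈ C → y⁻¹ * γ * y ∈ I) :
    Nat.card (fixedBy (G ⧸ I) γ) = Nat.card (fixedBy (G ⧸ C) γ) * I.relIndex C := by
  classical
  have hmem : ∀ (S : Subgroup G) (y : G), (y : G ⧸ S) ∈ fixedBy (G ⧸ S) γ ↔ y⁻¹ * γ * y ∈ S := fun S y => by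
    rw [MulAction.mem_fixedBy, MulAction.Quotient.smul_coe, smul_eq_mul, QuotientGroup.eq,
      show (γ * y)⁻¹ * y = (y⁻¹ * γ * y)⁻¹ by group, inv_mem_iff]
  set e := Subgroup.quotientEquivProdOfLE hIC with he
  have hfst : ∀ y : G, (e (y : G ⧸ I)).1 = (y : G ⧸ C) := fun y => rfl
  have hiff : ∀ q : G ⧸ I, q ∈ fixedBy (G ⧸ I) γ ↔ (e q).1 ∈ fixedBy (G ⧸ C) γ := by
    refine fun q => QuotientGroup.induction_on q fun y => ?_
    rw [hfst, hmem, hmem]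
    exact ⟨fun hy => hIC hy, fun hy => h y hy⟩
  have e' : fixedBy (G ⧸ I) γ ≃ fixedBy (G ⧸ C) γ × (C ⧸ I.subgroupOf C) :=
    (Equiv.subtypeEquiv e hiff).trans (Equiv.prodSubtypeFstEquivSubtypeProd (p := fun a : G ⧸ C => a ∈ fixedBy (G ⧸ C) γ))
  rw [Nat.card_congr e', Nat.card_prod]
  rfl

end Generic

/-! ## §2 `U₂ = U(Φ₂)(L⁺_v)` at a tame-ramified place: `[K⁰ : I] = 2`, no inversions for deep elements, and the edge∕vertex count -/

section CM

variable (L : Type) [Field L] [NumberField L] [IsCMField L] (v : HeightOneSpectrum (𝓞 ↥(maximalRealSubfield L)))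
  (w : PlacesOver L v) (hw : IsCMField.complexConj L • w.1 = w.1)

include hw in
/-- **A residually ANTIDIAGONAL integral unitary matrix is NOT in the `ϖ`-modular level `D_η GL₂(𝒪_w) D_η⁻¹`** (`η` a uniformiser): membership forces `|u₁₀|_w ≤ |η|_w < 1`
(entry `(1,0)` of `D_η⁻¹ u D_η` is `η⁻¹u₁₀`), and with `|u₁₁|_w < 1` this gives `|det u|_w < 1`, contradicting `|det u|_w = 1`. [cite: Tits1979, §3.9] [cite: Serre1980Trees, Ch. II §1.3] -/
theorem not_coe_mem_map_conj_glDiagonal_of_antidiagType (η : (w.1.adicCompletion L)ˣ) (hη : Valued.v (η : w.1.adicCompletion L) = WithZero.exp (-1 : ℤ))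
    (u : ↥(unitaryGroupOfForm (galAdicCompletionMap (L := L) (IsCMField.complexConj L) hw)
      (placeForm (Matrix.of fun i j : Fin 2 => if i.val + j.val + 1 = 2 then (1 : L) else 0) w.1)))
    (hu : (u : GL (Fin 2) (w.1.adicCompletion L)) ∈ glInt 2 (w.1.adicCompletion L))
    (h11 : Valued.v (((u : GL (Fin 2) (w.1.adicCompletion L)) : Matrix (Fin 2) (Fin 2) (w.1.adicCompletion L)) 1 1) < 1) :
    (u : GL (Fin 2) (w.1.adicCompletion L)) ∉
      (glInt 2 (w.1.adicCompletion L)).map (MulAut.conj (glDiagonal 2 (w.1.adicCompletion L) ![1, η])).toMonoidHom := by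
  intro hmem
  have hint : ∀ i j, Valued.v (((u : GL (Fin 2) (w.1.adicCompletion L)) : Matrix (Fin 2) (Fin 2) (w.1.adicCompletion L)) i j) ≤ 1 :=
    (coe_mem_glInt_iff_forall_v_le_one L w hw u).1 hu
  have hdet : Valued.v (((u : GL (Fin 2) (w.1.adicCompletion L)) : Matrix (Fin 2) (Fin 2) (w.1.adicCompletion L))).det = 1 := v_det_coe_eq_one_of_mem_placeForm L w hw u
  have hη0 : (η : (w.1.adicCompletion L)) ≠ 0 := η.ne_zero
  have hη1 : Valued.v (η : (w.1.adicCompletion L)) < 1 := by rw [hη, ← WithZero.exp_zero, WithZero.exp_lt_exp]; norm_num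
  -- entry `(1,0)`: `|η^0 (η^1)⁻¹ u₁₀| ≤ 1`
  have h10 := ((forall_v_sharp_iff_coe_mem_map_conj L w hw η u).2 hmem) 1 0
  simp only [Fin.val_one, Fin.val_zero, pow_one, pow_zero, one_mul] at h10
  have h10' : Valued.v (((u : GL (Fin 2) (w.1.adicCompletion L)) : Matrix (Fin 2) (Fin 2) (w.1.adicCompletion L)) 1 0) < 1 := by
    rw [Valuation.map_mul, map_inv₀] at h10
    have hvη : Valued.v (η : (w.1.adicCompletion L)) ≠ 0 := (Valuation.ne_zero_iff _).2 hη0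
    calc Valued.v (((u : GL (Fin 2) (w.1.adicCompletion L)) : Matrix (Fin 2) (Fin 2) (w.1.adicCompletion L)) 1 0)
        = Valued.v (η : (w.1.adicCompletion L)) * ((Valued.v (η : (w.1.adicCompletion L)))⁻¹ *
            Valued.v (((u : GL (Fin 2) (w.1.adicCompletion L)) : Matrix (Fin 2) (Fin 2) (w.1.adicCompletion L)) 1 0)) := by
          rw [← mul_assoc, mul_inv_cancel₀ hvη, one_mul]
      _ ≤ Valued.v (η : (w.1.adicCompletion L)) * 1 := mul_le_mul' le_rfl h10
      _ < 1 := by rw [mul_one]; exact hη1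
  have hlt : Valued.v (((u : GL (Fin 2) (w.1.adicCompletion L)) : Matrix (Fin 2) (Fin 2) (w.1.adicCompletion L))).det < 1 := by
    rw [Matrix.det_fin_two]
    refine Valuation.map_sub_lt _ ?_ ?_
    · rw [Valuation.map_mul, mul_comm]; exact mul_lt_one_of_lt_of_le h11 (hint 0 0)
    · rw [Valuation.map_mul, mul_comm]; exact mul_lt_one_of_lt_of_le h10' (hint 0 1)
  rw [hdet] at hlt
  exact lt_irrefl _ hlt

include hw in
/-- **`[K⁰ : K⁰ ∩ K♯] = 2` AT A TAME-RAMIFIED PLACE** — the Iwahori subgroup has index two in the edge stabiliser WITH inversion.  For subgroups `C, C′ ≤ U₂` matched by `E₂`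
with `GL₂(𝒪_w)` and `D_η GL₂(𝒪_w) D_η⁻¹` (`η` a uniformiser): `(C ⊓ C′).relIndex C = 2`.  The residual dichotomy (★ `valued_apply_dichotomy_of_mem_glInt_of_ramified`) splits `C`
into the diagonal type (`⊆ C′`, ★ `glDiagonal_inv_mul_mul_glDiagonal_mem_glInt_of_diagType`) and the antidiagonal type (disjoint from `C′`), and the flip `kJ` (★
`exists_mem_localNonsplitEquiv_eq_antidiagOne`) exchanges them. [cite: Serre1980Trees, Ch. II §1.3] [cite: Tits1979, §3.9] -/
theorem relIndex_inf_eq_two_of_ramified (he : v.asIdeal.ramificationIdx' w.1.asIdeal ≠ 1) (h2 : IsUnit (2 : 𝒪[(w.1.adicCompletion L)]))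
    (η : (w.1.adicCompletion L)ˣ) (hη : Valued.v (η : w.1.adicCompletion L) = WithZero.exp (-1 : ℤ))
    (C C' : Subgroup ((cmDatum L 2 (Matrix.of fun i j : Fin 2 => if i.val + j.val + 1 = 2 then (1 : L) else 0)).Local v))
    (hC : ∀ g, g ∈ C ↔ (((localNonsplitEquiv (IsCMField.complexConj L) (Matrix.of fun i j : Fin 2 => if i.val + j.val + 1 = 2 then (1 : L) else 0)
      (IsCMField.complexConj_ne_one L) w hw) g : ↥(unitaryGroupOfForm (galAdicCompletionMap (L := L) (IsCMField.complexConj L) hw)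
        (placeForm (Matrix.of fun i j : Fin 2 => if i.val + j.val + 1 = 2 then (1 : L) else 0) w.1))) : GL (Fin 2) (w.1.adicCompletion L)) ∈
        glInt 2 (w.1.adicCompletion L))
    (hC' : ∀ g, g ∈ C' ↔ (((localNonsplitEquiv (IsCMField.complexConj L) (Matrix.of fun i j : Fin 2 => if i.val + j.val + 1 = 2 then (1 : L) else 0)
      (IsCMField.complexConj_ne_one L) w hw) g : ↥(unitaryGroupOfForm (galAdicCompletionMap (L := L) (IsCMField.complexConj L) hw)
        (placeForm (Matrix.of fun i j : Fin 2 => if i.val + j.val + 1 = 2 then (1 : L) else 0) w.1))) : GL (Fin 2) (w.1.adicCompletion L)) ∈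
        (glInt 2 (w.1.adicCompletion L)).map (MulAut.conj (glDiagonal 2 (w.1.adicCompletion L) ![1, η])).toMonoidHom) :
    (C ⊓ C').relIndex C = 2 := by
  have h2w : Valued.v (2 : (w.1.adicCompletion L)) = 1 := by
    rw [Valuation.Integers.isUnit_iff_valuation_eq_one (Valuation.integer.integers (ValuativeRel.valuation (w.1.adicCompletion L))),
      (ValuativeRel.isEquiv (ValuativeRel.valuation (w.1.adicCompletion L)) (Valued.v : Valuation (w.1.adicCompletion L) _)).eq_one_iff_eq_one] at h2
    exact h2
  -- `C` is the integral level `U(Φ₂)(𝒪_v)`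
  have hCeq : C = cmLocalIntegralLevel L 2 (Matrix.of fun i j : Fin 2 => if i.val + j.val + 1 = 2 then (1 : L) else 0) v := by
    ext g
    rw [hC g]
    exact (mem_localIntegralLevel_iff_of_smul_eq (IsCMField.complexConj L) 2 (Matrix.of fun i j : Fin 2 => if i.val + j.val + 1 = 2 then (1 : L) else 0)
      (IsCMField.complexConj_ne_one L) w hw g).symm
  -- the flip `kJ ∈ C`, `E₂ kJ = antidiag(1,1)`: `E₂(kJ b)` is `E₂ b` with its rows exchanged
  obtain ⟨kJ, hkJC, hkJ⟩ : ∃ kJ : ((cmDatum L 2 (Matrix.of fun i j : Fin 2 => if i.val + j.val + 1 = 2 then (1 : L) else 0)).Local v), kJ ∈ C ∧ ((((localNonsplitEquiv (IsCMField.complexConj L) (Matrix.of fun i j : Fin 2 => if i.val + j.val + 1 = 2 then (1 : L) else 0) (IsCMField.complexConj_ne_one L) w hw) kJ : ↥(unitaryGroupOfForm (galAdicCompletionMap (L := L) (IsCMField.complexConj L) hw) (placeForm (Matrix.of fun i j : Fin 2 => if i.val + j.val + 1 = 2 then (1 : L) else 0) w.1))) : GL (Fin 2) (w.1.adicCompletion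 L)) : Matrix (Fin 2) (Fin 2) (w.1.adicCompletion L)) = !![(0 : (w.1.adicCompletion L)), 1; 1, 0] :=
    exists_mem_localNonsplitEquiv_eq_antidiagOne L v w hw C hCeq
  have e11 : ∀ b : ((cmDatum L 2 (Matrix.of fun i j : Fin 2 => if i.val + j.val + 1 = 2 then (1 : L) else 0)).Local v), ((((localNonsplitEquiv (IsCMField.complexConj L) (Matrix.of fun i j : Fin 2 => if i.val + j.val + 1 = 2 then (1 : L) else 0) (IsCMField.complexConj_ne_one L) w hw) (kJ * b) : ↥(unitaryGroupOfForm (galAdicCompletionMap (L := L) (IsCMField.complexConj L) hw) (placeForm (Matrix.of fun i j : Fin 2 => if i.val + j.val + 1 = 2 then (1 : L) else 0) w.1))) : GL (Fin 2) (w.1.adicCompletion L)) : Matrix (Fin 2) (Fin 2) (w.1.adicCompletion L)) 1 1 = ((((localNonsplitEquiv (IsCMField.complexConj L) (Matrix.of fun i j : Fin 2 => if i.val + j.val + 1 = 2 then (1 : L) else 0) (IsCMField.complexConj_ne_one L) w hw) b : ↥(unitaryGroupOfForm (galAdicCompletionMap (L := L) (IsCMField.complexConj L) hw) (placeForm (Matrix.of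 fun i j : Fin 2 => if i.val + j.val + 1 = 2 then (1 : L) else 0) w.1))) : GL (Fin 2) (w.1.adicCompletion L)) : Matrix (Fin 2) (Fin 2) (w.1.adicCompletion L)) 0 1 := fun b =>
    (localNonsplitEquiv_flip_mul_apply L v w hw kJ hkJ b).2.2.2
  have e10 : ∀ b : ((cmDatum L 2 (Matrix.of fun i j : Fin 2 => if i.val + j.val + 1 = 2 then (1 : L) else 0)).Local v), ((((localNonsplitEquiv (IsCMField.complexConj L) (Matrix.of fun i j : Fin 2 => if i.val + j.val + 1 = 2 then (1 : L) else 0) (IsCMField.complexConj_ne_one L) w hw) (kJ * b) : ↥(unitaryGroupOfForm (galAdicCompletionMap (L := L) (IsCMField.complexConj L) hw) (placeForm (Matrix.of fun i j : Fin 2 => if i.val + j.val + 1 = 2 then (1 : L) else 0) w.1))) : GL (Fin 2) (w.1.adicCompletion L)) : Matrix (Fin 2) (Fin 2) (w.1.adicCompletion L)) 1 0 = ((((localNonsplitEquiv (IsCMField.complexConj L) (Matrix.of fun i j : Fin 2 => if i.val + j.val + 1 = 2 then (1 : L) else 0) (IsCMField.complexConj_ne_one L) w hw) b : ↥(unitaryGroupOfForm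 (galAdicCompletionMap (L := L) (IsCMField.complexConj L) hw) (placeForm (Matrix.of fun i j : Fin 2 => if i.val + j.val + 1 = 2 then (1 : L) else 0) w.1))) : GL (Fin 2) (w.1.adicCompletion L)) : Matrix (Fin 2) (Fin 2) (w.1.adicCompletion L)) 0 0 := fun b =>
    (localNonsplitEquiv_flip_mul_apply L v w hw kJ hkJ b).2.2.1
  -- the residual dichotomy sorts `C` into `C′`-members (diagonal type) and non-members (antidiagonal type), and `kJ` exchanges them
  have hkey : ∀ b : ((cmDatum L 2 (Matrix.of fun i j : Fin 2 => if i.val + j.val + 1 = 2 then (1 : L) else 0)).Local v), b ∈ C → (b ∈ C' ∧ kJ * b ∉ C') ∨ (b ∉ C' ∧ kJ * b ∈ C') := by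
    intro b hb
    have hbI := (hC b).1 hb
    have hkbI := (hC (kJ * b)).1 (C.mul_mem hkJC hb)
    rcases valued_apply_dichotomy_of_mem_glInt_of_ramified L w hw he h2w _ hbI with ⟨h10, h01⟩ | ⟨h00, h11⟩
    · refine Or.inl ⟨(hC' b).2 (Subgroup.mem_map_equiv.2 ?_), fun hk => ?_⟩
      · rw [MulAut.conj_symm_apply]
        exact glDiagonal_inv_mul_mul_glDiagonal_mem_glInt_of_diagType L w hw η hη _ hbI h10
      · exact not_coe_mem_map_conj_glDiagonal_of_antidiagType L v w hw η hη _ hkbI (by rw [e11]; exact h01) ((hC' _).1 hk)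
    · refine Or.inr ⟨fun hb' => not_coe_mem_map_conj_glDiagonal_of_antidiagType L v w hw η hη _ hbI h11 ((hC' b).1 hb'), ?_⟩
      refine (hC' _).2 (Subgroup.mem_map_equiv.2 ?_)
      rw [MulAut.conj_symm_apply]
      exact glDiagonal_inv_mul_mul_glDiagonal_mem_glInt_of_diagType L w hw η hη _ hkbI (by rw [e10]; exact h00)
  rw [Subgroup.relIndex, Subgroup.index_eq_two_iff']
  refine ⟨⟨kJ, hkJC⟩, fun b => ?_⟩
  simp only [Subgroup.mem_subgroupOf, Subgroup.coe_mul, Subgroup.mem_inf]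
  rcases hkey b b.2 with ⟨hbC', hk⟩ | ⟨hbC', hk⟩
  · exact Or.inr ⟨⟨b.2, hbC'⟩, fun h => hk h.2⟩
  · exact Or.inl ⟨⟨C.mul_mem hkJC b.2, hk⟩, fun h => hbC' h.2⟩

include hw in
/-- **NO INVERSIONS FOR DEEP ELEMENTS**: if `|tr γ_w − 2|_w < 1` (and `|2|_w = 1`), every conjugate `y⁻¹γy` lying in `C = K⁰` lies in `C′ = K♯` as well (hence in the Iwahori
`K⁰ ∩ K♯`): the conjugate has trace `tr γ_w`, of absolute value `1`, so it is not residually antidiagonal (`|κ₀₀|, |κ₁₁| < 1` would give `|tr κ| < 1`), hence residually diagonal and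
in `K♯` (★ `glDiagonal_inv_mul_mul_glDiagonal_mem_glInt_of_diagType`). [cite: Serre1980Trees, Ch. I §6.1; Ch. II §1.3] [cite: Tits1979, §3.9] -/
theorem conj_mem_of_conj_mem_of_deep_of_ramified (he : v.asIdeal.ramificationIdx' w.1.asIdeal ≠ 1) (h2 : IsUnit (2 : 𝒪[(w.1.adicCompletion L)]))
    (η : (w.1.adicCompletion L)ˣ) (hη : Valued.v (η : w.1.adicCompletion L) = WithZero.exp (-1 : ℤ))
    (C C' : Subgroup ((cmDatum L 2 (Matrix.of fun i j : Fin 2 => if i.val + j.val + 1 = 2 then (1 : L) else 0)).Local v))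
    (hC : ∀ g, g ∈ C ↔ (((localNonsplitEquiv (IsCMField.complexConj L) (Matrix.of fun i j : Fin 2 => if i.val + j.val + 1 = 2 then (1 : L) else 0) (IsCMField.complexConj_ne_one L) w hw) g : ↥(unitaryGroupOfForm (galAdicCompletionMap (L := L) (IsCMField.complexConj L) hw) (placeForm (Matrix.of fun i j : Fin 2 => if i.val + j.val + 1 = 2 then (1 : L) else 0) w.1))) : GL (Fin 2) (w.1.adicCompletion L)) ∈ glInt 2 (w.1.adicCompletion L))
    (hC' : ∀ g, g ∈ C' ↔ (((localNonsplitEquiv (IsCMField.complexConj L) (Matrix.of fun i j : Fin 2 => if i.val + j.val + 1 = 2 then (1 : L) else 0) (IsCMField.complexConj_ne_one L) w hw) g : ↥(unitaryGroupOfForm (galAdicCompletionMap (L := L) (IsCMField.complexConj L) hw) (placeForm (Matrix.of fun i j : Fin 2 => if i.val + j.val + 1 = 2 then (1 : L) else 0) w.1))) : GL (Fin 2) (w.1.adicCompletion L)) ∈ (glInt 2 (w.1.adicCompletion L)).map (MulAut.conj (glDiagonal 2 (w.1.adicCompletion L) ![1, η])).toMonoidHom)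
    (γ : ((cmDatum L 2 (Matrix.of fun i j : Fin 2 => if i.val + j.val + 1 = 2 then (1 : L) else 0)).Local v)) (htr : Valued.v ((((γ.val : GL (Fin 2) (UnitaryGroup.LocalRing L v)).val.map (Pi.evalRingHom (fun w' : PlacesOver L v => w'.1.adicCompletion L) w))).trace - 2) < 1)
    (y : ((cmDatum L 2 (Matrix.of fun i j : Fin 2 => if i.val + j.val + 1 = 2 then (1 : L) else 0)).Local v)) (hy : y⁻¹ * γ * y ∈ C) : y⁻¹ * γ * y ∈ C' := by
  have h2w : Valued.v (2 : (w.1.adicCompletion L)) = 1 := by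
    rw [Valuation.Integers.isUnit_iff_valuation_eq_one (Valuation.integer.integers (ValuativeRel.valuation (w.1.adicCompletion L))),
      (ValuativeRel.isEquiv (ValuativeRel.valuation (w.1.adicCompletion L)) (Valued.v : Valuation (w.1.adicCompletion L) _)).eq_one_iff_eq_one] at h2
    exact h2
  have hκI := (hC _).1 hy
  -- the trace of the conjugate is `tr γ_w`, of absolute value `|2|_w = 1`
  have hcoe : ((((localNonsplitEquiv (IsCMField.complexConj L) (Matrix.of fun i j : Fin 2 => if i.val + j.val + 1 = 2 then (1 : L) else 0) (IsCMField.complexConj_ne_one L) w hw) γ : ↥(unitaryGroupOfForm (galAdicCompletionMap (L := L) (IsCMField.complexConj L) hw) (placeForm (Matrix.of fun i j : Fin 2 => if i.val + j.val + 1 = 2 then (1 : L) else 0) w.1))) : GL (Fin 2) (w.1.adicCompletion L)) : Matrix (Fin 2) (Fin 2) (w.1.adicCompletion L)) = (((γ.val : GL (Fin 2) (UnitaryGroup.LocalRing L v)).val.map (Pi.evalRingHom (fun w' : PlacesOver L v => w'.1.adicCompletion L) w))) := rfl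
  have hGL : (((localNonsplitEquiv (IsCMField.complexConj L) (Matrix.of fun i j : Fin 2 => if i.val + j.val + 1 = 2 then (1 : L) else 0) (IsCMField.complexConj_ne_one L) w hw) (y⁻¹ * γ * y) : ↥(unitaryGroupOfForm (galAdicCompletionMap (L := L) (IsCMField.complexConj L) hw) (placeForm (Matrix.of fun i j : Fin 2 => if i.val + j.val + 1 = 2 then (1 : L) else 0) w.1))) : GL (Fin 2) (w.1.adicCompletion L)) = ((((localNonsplitEquiv (IsCMField.complexConj L) (Matrix.of fun i j : Fin 2 => if i.val + j.val + 1 = 2 then (1 : L) else 0) (IsCMField.complexConj_ne_one L) w hw) y : ↥(unitaryGroupOfForm (galAdicCompletionMap (L := L) (IsCMField.complexConj L) hw) (placeForm (Matrix.of fun i j : Fin 2 => if i.val + j.val + 1 = 2 then (1 : L) else 0) w.1))) : GL (Fin 2) (w.1.adicCompletion L)))⁻¹ * (((localNonsplitEquiv (IsCMField.complexConj L) (Matrix.of fun i j : Fin 2 => if i.val + j.val + 1 = 2 then (1 : L) else 0) (IsCMField.complexConj_ne_one L) w hw) γ : ↥(unitaryGroupOfForm (galAdicCompletionMap (L := L)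 (IsCMField.complexConj L) hw) (placeForm (Matrix.of fun i j : Fin 2 => if i.val + j.val + 1 = 2 then (1 : L) else 0) w.1))) : GL (Fin 2) (w.1.adicCompletion L)) * (((localNonsplitEquiv (IsCMField.complexConj L) (Matrix.of fun i j : Fin 2 => if i.val + j.val + 1 = 2 then (1 : L) else 0) (IsCMField.complexConj_ne_one L) w hw) y : ↥(unitaryGroupOfForm (galAdicCompletionMap (L := L) (IsCMField.complexConj L) hw) (placeForm (Matrix.of fun i j : Fin 2 => if i.val + j.val + 1 = 2 then (1 : L) else 0) w.1))) : GL (Fin 2) (w.1.adicCompletion L)) := by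
    have h1 : (((localNonsplitEquiv (IsCMField.complexConj L) (Matrix.of fun i j : Fin 2 => if i.val + j.val + 1 = 2 then (1 : L) else 0) (IsCMField.complexConj_ne_one L) w hw) (y⁻¹ * γ * y⁻¹⁻¹) : ↥(unitaryGroupOfForm (galAdicCompletionMap (L := L) (IsCMField.complexConj L) hw) (placeForm (Matrix.of fun i j : Fin 2 => if i.val + j.val + 1 = 2 then (1 : L) else 0) w.1))) : GL (Fin 2) (w.1.adicCompletion L)) = (((localNonsplitEquiv (IsCMField.complexConj L) (Matrix.of fun i j : Fin 2 => if i.val + j.val + 1 = 2 then (1 : L) else 0) (IsCMField.complexConj_ne_one L) w hw) y⁻¹ : ↥(unitaryGroupOfForm (galAdicCompletionMap (L := L) (IsCMField.complexConj L) hw) (placeForm (Matrix.of fun i j : Fin 2 => if i.val + j.val + 1 = 2 then (1 : L) else 0) w.1))) : GL (Fin 2) (w.1.adicCompletion L)) * (((localNonsplitEquiv (IsCMField.complexConj L) (Matrix.of fun i j : Fin 2 => if i.val + j.val + 1 = 2 then (1 : L) else 0) (IsCMField.complexConj_ne_one L) w hw) γ : ↥(unitaryGroupOfForm (galAdicCompletionMap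 (L := L) (IsCMField.complexConj L) hw) (placeForm (Matrix.of fun i j : Fin 2 => if i.val + j.val + 1 = 2 then (1 : L) else 0) w.1))) : GL (Fin 2) (w.1.adicCompletion L)) * ((((localNonsplitEquiv (IsCMField.complexConj L) (Matrix.of fun i j : Fin 2 => if i.val + j.val + 1 = 2 then (1 : L) else 0) (IsCMField.complexConj_ne_one L) w hw) y⁻¹ : ↥(unitaryGroupOfForm (galAdicCompletionMap (L := L) (IsCMField.complexConj L) hw) (placeForm (Matrix.of fun i j : Fin 2 => if i.val + j.val + 1 = 2 then (1 : L) else 0) w.1))) : GL (Fin 2) (w.1.adicCompletion L)))⁻¹ :=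
      coe_localNonsplitEquiv_conj L v w hw y⁻¹ γ
    have h2 : (((localNonsplitEquiv (IsCMField.complexConj L) (Matrix.of fun i j : Fin 2 => if i.val + j.val + 1 = 2 then (1 : L) else 0) (IsCMField.complexConj_ne_one L) w hw) y⁻¹ : ↥(unitaryGroupOfForm (galAdicCompletionMap (L := L) (IsCMField.complexConj L) hw) (placeForm (Matrix.of fun i j : Fin 2 => if i.val + j.val + 1 = 2 then (1 : L) else 0) w.1))) : GL (Fin 2) (w.1.adicCompletion L)) = ((((localNonsplitEquiv (IsCMField.complexConj L) (Matrix.of fun i j : Fin 2 => if i.val + j.val + 1 = 2 then (1 : L) else 0) (IsCMField.complexConj_ne_one L) w hw) y : ↥(unitaryGroupOfForm (galAdicCompletionMap (L := L) (IsCMField.complexConj L) hw) (placeForm (Matrix.of fun i j : Fin 2 => if i.val + j.val + 1 = 2 then (1 : L) else 0) w.1))) : GL (Fin 2) (w.1.adicCompletion L)))⁻¹ := coe_localNonsplitEquiv_inv L v w hw y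
    rw [inv_inv] at h1
    rw [h1, h2, inv_inv]
  have htrκ : ((((localNonsplitEquiv (IsCMField.complexConj L) (Matrix.of fun i j : Fin 2 => if i.val + j.val + 1 = 2 then (1 : L) else 0) (IsCMField.complexConj_ne_one L) w hw) (y⁻¹ * γ * y) : ↥(unitaryGroupOfForm (galAdicCompletionMap (L := L) (IsCMField.complexConj L) hw) (placeForm (Matrix.of fun i j : Fin 2 => if i.val + j.val + 1 = 2 then (1 : L) else 0) w.1))) : GL (Fin 2) (w.1.adicCompletion L)) : Matrix (Fin 2) (Fin 2) (w.1.adicCompletion L)).trace = (((γ.val : GL (Fin 2) (UnitaryGroup.LocalRing L v)).val.map (Pi.evalRingHom (fun w' : PlacesOver L v => w'.1.adicCompletion L) w))).trace := by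
    rw [← hcoe, hGL, Units.val_mul, Units.val_mul, Matrix.trace_units_conj']
  have htr1 : Valued.v (((γ.val : GL (Fin 2) (UnitaryGroup.LocalRing L v)).val.map (Pi.evalRingHom (fun w' : PlacesOver L v => w'.1.adicCompletion L) w))).trace = 1 := by
    rw [← h2w]
    refine Valuation.map_eq_of_sub_lt _ ?_
    rw [h2w]; exact htr
  rcases valued_apply_dichotomy_of_mem_glInt_of_ramified L w hw he h2w _ hκI with ⟨h10, -⟩ | ⟨h00, h11⟩
  · refine (hC' _).2 (Subgroup.mem_map_equiv.2 ?_)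
    rw [MulAut.conj_symm_apply]
    exact glDiagonal_inv_mul_mul_glDiagonal_mem_glInt_of_diagType L w hw η hη _ hκI h10
  · exfalso
    have hlt : Valued.v ((((localNonsplitEquiv (IsCMField.complexConj L) (Matrix.of fun i j : Fin 2 => if i.val + j.val + 1 = 2 then (1 : L) else 0) (IsCMField.complexConj_ne_one L) w hw) (y⁻¹ * γ * y) : ↥(unitaryGroupOfForm (galAdicCompletionMap (L := L) (IsCMField.complexConj L) hw) (placeForm (Matrix.of fun i j : Fin 2 => if i.val + j.val + 1 = 2 then (1 : L) else 0) w.1))) : GL (Fin 2) (w.1.adicCompletion L)) : Matrix (Fin 2) (Fin 2) (w.1.adicCompletion L)).trace < 1 := by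
      rw [Matrix.trace_fin_two]; exact Valuation.map_add_lt _ h00 h11
    rw [htrκ, htr1] at hlt
    exact lt_irrefl _ hlt

include hw in
/-- **HEAD — `#Fix_γ(U₂ ⧸ K⁰) + 1 = #Fix_γ(U₂ ⧸ K♯)` FOR A DEEP REGULAR ELLIPTIC `γ` AT A TAME-RAMIFIED PLACE.**  `v` tame-ramified non-split (`e(w|v) ≠ 1`, `2 ∈ 𝒪_w^×`), `η` a
uniformiser of `L_w`, `C ↔ GL₂(𝒪_w)` and `C′ ↔ D_η GL₂(𝒪_w) D_η⁻¹` compact open subgroups of `U₂ = U(Φ₂)(L⁺_v)` given by their `E₂`-dictionaries, `γ ∈ U₂` regular with compact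
centraliser and DEEP (`|tr γ_w − 2|_w < 1`).  Proof: Kottwitz's (E) ★ `natCard_fixedBy_add_eq_natCard_fixedBy_add_one_of_isRegularElt_of_ramified` at `I = C ⊓ C′`, and
`#Fix(U₂⧸I) = 2·#Fix(U₂⧸C)` by §1 with `[C : I] = 2` (`relIndex_inf_eq_two_of_ramified`) and no inversions (`conj_mem_of_conj_mem_of_deep_of_ramified`).  For a type-(2) `γ_H.1` these
are the EDGE and VERTEX counts `(m⁰, m♯)` of B-p14 (g38)'s certificate; the vertex count is ★ p847070. [cite: Kottwitz1988, §2 Theorem 2] [cite: Serre1980Trees, Ch. I §6.1; Ch. II §1.3]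
[cite: LabesseLanglands1979, §2 p. 8] -/
theorem natCard_fixedBy_add_one_eq_natCard_fixedBy_of_deep_of_ramified (he : v.asIdeal.ramificationIdx' w.1.asIdeal ≠ 1) (h2 : IsUnit (2 : 𝒪[(w.1.adicCompletion L)]))
    (η : (w.1.adicCompletion L)ˣ) (hη : Valued.v (η : w.1.adicCompletion L) = WithZero.exp (-1 : ℤ))
    (C C' : Subgroup ((cmDatum L 2 (Matrix.of fun i j : Fin 2 => if i.val + j.val + 1 = 2 then (1 : L) else 0)).Local v))
    (hC : ∀ g, g ∈ C ↔ (((localNonsplitEquiv (IsCMField.complexConj L) (Matrix.of fun i j : Fin 2 => if i.val + j.val + 1 = 2 then (1 : L) else 0) (IsCMField.complexConj_ne_one L) w hw) g : ↥(unitaryGroupOfForm (galAdicCompletionMap (L := L) (IsCMField.complexConj L) hw) (placeForm (Matrix.of fun i j : Fin 2 => if i.val + j.val + 1 = 2 then (1 : L) else 0) w.1))) : GL (Fin 2) (w.1.adicCompletion L)) ∈ glInt 2 (w.1.adicCompletion L))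
    (hC' : ∀ g, g ∈ C' ↔ (((localNonsplitEquiv (IsCMField.complexConj L) (Matrix.of fun i j : Fin 2 => if i.val + j.val + 1 = 2 then (1 : L) else 0) (IsCMField.complexConj_ne_one L) w hw) g : ↥(unitaryGroupOfForm (galAdicCompletionMap (L := L) (IsCMField.complexConj L) hw) (placeForm (Matrix.of fun i j : Fin 2 => if i.val + j.val + 1 = 2 then (1 : L) else 0) w.1))) : GL (Fin 2) (w.1.adicCompletion L)) ∈ (glInt 2 (w.1.adicCompletion L)).map (MulAut.conj (glDiagonal 2 (w.1.adicCompletion L) ![1, η])).toMonoidHom)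
    (hCo : IsOpen (C : Set ((cmDatum L 2 (Matrix.of fun i j : Fin 2 => if i.val + j.val + 1 = 2 then (1 : L) else 0)).Local v))) (hCc : IsCompact (C : Set ((cmDatum L 2 (Matrix.of fun i j : Fin 2 => if i.val + j.val + 1 = 2 then (1 : L) else 0)).Local v))) (hC'o : IsOpen (C' : Set ((cmDatum L 2 (Matrix.of fun i j : Fin 2 => if i.val + j.val + 1 = 2 then (1 : L) else 0)).Local v))) (hC'c : IsCompact (C' : Set ((cmDatum L 2 (Matrix.of fun i j : Fin 2 => if i.val + j.val + 1 = 2 then (1 : L) else 0)).Local v)))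
    (γ : ((cmDatum L 2 (Matrix.of fun i j : Fin 2 => if i.val + j.val + 1 = 2 then (1 : L) else 0)).Local v)) (hreg : IsRegularElt (γ.val : GL (Fin 2) (UnitaryGroup.LocalRing L v)))
    [hc : CompactSpace (Subgroup.centralizer ({γ} : Set ((cmDatum L 2 (Matrix.of fun i j : Fin 2 => if i.val + j.val + 1 = 2 then (1 : L) else 0)).Local v)))]
    (htr : Valued.v ((((γ.val : GL (Fin 2) (UnitaryGroup.LocalRing L v)).val.map (Pi.evalRingHom (fun w' : PlacesOver L v => w'.1.adicCompletion L) w))).trace - 2) < 1) :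
    Nat.card (fixedBy (((cmDatum L 2 (Matrix.of fun i j : Fin 2 => if i.val + j.val + 1 = 2 then (1 : L) else 0)).Local v) ⧸ C) γ) + 1 = Nat.card (fixedBy (((cmDatum L 2 (Matrix.of fun i j : Fin 2 => if i.val + j.val + 1 = 2 then (1 : L) else 0)).Local v) ⧸ C') γ) := by
  have hEP := natCard_fixedBy_add_eq_natCard_fixedBy_add_one_of_isRegularElt_of_ramified L v w hw he h2 η hη C C' (C ⊓ C') hC hC'
    (fun g => Subgroup.mem_inf) hCo hCc hC'o hC'c γ hreg hc
  have hcov := natCard_fixedBy_quotient_eq_mul_relIndex_of_forall_conj_mem (inf_le_left : C ⊓ C' ≤ C) γ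
    (fun y hy => Subgroup.mem_inf.2 ⟨hy, conj_mem_of_conj_mem_of_deep_of_ramified L v w hw he h2 η hη C C' hC hC' γ htr y hy⟩)
  rw [relIndex_inf_eq_two_of_ramified L v w hw he h2 η hη C C' hC hC'] at hcov
  omega

end CM

end Literature.NumberTheory.Automorphic.UnitaryGroup

end
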